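import Summits.FinalStateConjecture.FinalStateConjecture.Theorems.PhotonSphereChannelsChannelsResolveTameDevelopmentsRHorizonHullCurvature
import Summits.FinalStateConjecture.FinalStateConjecture.Theorems.PhotonSphereChannelsChannelsResolveTameDevelopmentsRKerrDocOfLocalIsometry
import HarnessLib

/-!
# Route PhotonSphereChannels · crux `ChannelsResolveTameDevelopmentsR` (K2R-T2, stmt-FinalStateConjecture-17430) ·
# line `tame-lasalle-dock` · stub N `stub_noExtremalShadow`: the CURVATURE FINGERPRINT of a Kerr shadow along a
# horizon generator path (extremal or not)

Stub N excludes, for developments as in Φ, silent hull elements whose domain of outer communications `E.doc` is the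
image of an injective local isometry `Ψ` of an EXTREMAL smooth Kerr exterior. Its intended proof pins the Kerr
parameters along the horizon generator path `γ` on which the element is based. This file proves the curvature half
of that pinning for isometric Kerr copies in the shape N and the docked rigidity SEK produce them (a local isometry of
`(Kerr.exterior M' a, Kerr.smoothMetric M' a r₊)` onto `E.doc`, NO orientation clause, ANY `0 < M'`, `a`), kernel-checked:

* §1 **Kerr's Kretschmann scalar is bounded by the mass.** From the closed form
  `|Rm|² = 48 M² Re (r + i a cos θ)⁶ / (r² + a² cos² θ)⁶` (`Kerr.kretschmannScalar_closedForm_holds`) and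
  `|Re z⁶| ≤ |z|⁶ = (r² + a²cos²θ)³`: `| |Rm|²_{g_{M,a}}(x) | ≤ 48 M² / r⁶` wherever `r > 0`
  (`abs_rmNormSqAt_kerr_le`), hence `< 48 / M⁴` on the whole exterior `{r > r₊}` since `r₊ ≥ M`
  (`abs_rmNormSqAt_lt_of_mem_exterior`; for extremal parameters `r₊ = M` — the landed `MinkowskiModel.rPlus_of_isExtremal` —
  and the bound is attained in the closure, at the equatorial horizon).
* §2 **Transport to an isometric copy.** Along a local isometry `Ψ` of the smooth Kerr exterior into `𝓢`,
  `|Rm|²_𝓢(Ψ x) = |Rm|²_{g_{M,a}}(x)` (`kretschmannAt_of_isLocalIsometry_kerrExterior`: G4's deviation identity +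
  `DarkFuture.kretschmannAt_kerrChart`); so on `closure (range Ψ)` the host's scalar lies in the closed value set of
  Kerr's and has modulus `≤ 48 / M⁴` (continuity of `kretschmannAt`, `…RKretschmannContinuity`).
* §3 **The fingerprint along `γ`.** If a horizon-hull element `(𝓢, E, p)` along `γ` has `E.doc = range Ψ` for such a
  `Ψ` with `0 < M'`, then `K := |Rm|²_𝓢(p)` (i) lies in the closure of Kerr's value set on the exterior, (ii) has
  `|K| ≤ 48 / M'⁴`, and (iii) is a CLUSTER VALUE at `+∞` of the development's curvature `s ↦ |Rm|²_𝒟(γ s)`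
  (`p ∈ E.horizon ⊆ closure E.doc`; `DarkFuture.mapClusterPt_kretschmannAt_of_isHorizonHullElement`)
  (`kerrShadow_fingerprint`). Consequences: a curvature floor `κ ≤ |Rm|²_𝒟 ∘ γ` eventually forces `M'⁴ ≤ 48 / κ` for
  EVERY Kerr shadow along `γ` — extremal included, either orientation (`mass_pow_four_le_of_kerrShadow_of_le`); if
  `|Rm|²_𝒟 ∘ γ → K∞` then `|K∞| · M'⁴ ≤ 48` (`abs_mul_mass_pow_four_le_of_kerrShadow_of_tendsto`); the extremal
  specialisation `extremalShadow_fingerprint`; registered summary `kerrShadow_fingerprint_along`.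

What this does NOT give (reported to the lead): the value `K` is only placed in the closed value set of Kerr's scalar
(localisation (L) of `p` at `r = r₊` of the chart is not available from `p ∈ E.horizon`), and one scalar at one point
does not separate extremal from sub-extremal parameters; the mass bound is the usable output.

References: M. Visser, arXiv:0706.0622, §3 (Kretschmann scalar of Kerr) [arXiv07060622]; B. O'Neill, *The Geometry of
Kerr Black Holes* (1995), Ch. 2 §2.3 [ONeill1995]; B. O'Neill, *Semi-Riemannian Geometry* (1983), Ch. 3, pp. 90–91
[ONeill1983]; P. Petersen, *Riemannian Geometry*, 2nd ed. (2006), Ch. 10 §3.2 [Petersen2006].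
-/

noncomputable section

-- the operator-norm instance on `E4 →L[ℝ] E4 →L[ℝ] ℝ` needs one more level of pending
-- instance problems than the default (as in `PhotonSphereChannelsTameHullDefs.lean`)
set_option maxSynthPendingDepth 3
-- every `Summit.FinalStateConjecture.FinalStateConjecture.…` name repeats the summit = sub-problem segment (D-0017 layout)
set_option linter.dupNamespace false

open Set Filter Function TopologicalSpace Manifold Bundle
open scoped Topology Manifold ContDiff ENNReal NNReal

namespace Summit.FinalStateConjecture.FinalStateConjecture.Theorems.TameLaSalle

open Literature.Geometry.Lorentzian
open Summit.FinalStateConjecture.FinalStateConjecture.Theorems.TameHull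
open Summit.FinalStateConjecture.FinalStateConjecture.Theorems.DarkFuture
open Summit.FinalStateConjecture.FinalStateConjecture.Theorems.HullCurvature

/-! ### §1 Kerr's Kretschmann scalar is bounded by the mass -/

/-- **`| |Rm|²_{g_{M,a}}(x) | ≤ 48 M² / r⁶` wherever `r > 0`**: in the closed form
`48 M² Re (r + i a cos θ)⁶ / (r² + a² cos² θ)⁶`, `|Re z⁶| ≤ |z|⁶ = (r² + a² cos² θ)³` and
`r² + a² cos² θ ≥ r²`. [cite: arXiv07060622, §3] -/
theorem abs_rmNormSqAt_kerr_le (M a : ℝ) {x : E4} (hr : 0 < Kerr.radius a x) :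
    |MetricCoord.rmNormSqAt (Kerr.bilin M a) x| ≤ 48 * M ^ 2 / Kerr.radius a x ^ 6 := by
  rw [Kerr.kretschmannScalar_closedForm_holds M a x hr]
  set r : ℝ := Kerr.radius a x with hr_def
  set c : ℝ := a * (x 3 / r) with hc_def
  set z : ℂ := (r : ℂ) + (c : ℂ) * Complex.I with hz_def
  have hz : ‖z‖ ^ 2 = r ^ 2 + c ^ 2 := by
    rw [Complex.sq_norm, hz_def, Complex.normSq_add_mul_I]
  have hden : 0 < r ^ 2 + c ^ 2 := by positivity
  have hre : |(z ^ 6).re| ≤ (r ^ 2 + c ^ 2) ^ 3 := by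
    calc |(z ^ 6).re| ≤ ‖z ^ 6‖ := Complex.abs_re_le_norm _
      _ = (‖z‖ ^ 2) ^ 3 := by rw [norm_pow]; ring
      _ = (r ^ 2 + c ^ 2) ^ 3 := by rw [hz]
  rw [abs_div, abs_mul, abs_of_nonneg (by positivity : (0 : ℝ) ≤ 48 * M ^ 2),
    abs_of_pos (by positivity : (0 : ℝ) < (r ^ 2 + c ^ 2) ^ 6)]
  calc 48 * M ^ 2 * |(z ^ 6).re| / (r ^ 2 + c ^ 2) ^ 6
      ≤ 48 * M ^ 2 * (r ^ 2 + c ^ 2) ^ 3 / (r ^ 2 + c ^ 2) ^ 6 := by gcongr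
    _ = 48 * M ^ 2 / (r ^ 2 + c ^ 2) ^ 3 := by
        field_simp
    _ ≤ 48 * M ^ 2 / r ^ 6 := by
        apply div_le_div_of_nonneg_left (by positivity) (by positivity)
        calc r ^ 6 = (r ^ 2) ^ 3 := by ring
          _ ≤ (r ^ 2 + c ^ 2) ^ 3 := by gcongr; nlinarith [sq_nonneg c]

/-- **On the Kerr exterior `{r > r₊}` with `0 < M`, `| |Rm|²_{g_{M,a}} | < 48 / M⁴`** (`48M²/r⁶` with
`r > r₊ = M + √(M² − a²) ≥ M > 0`, the landed `le_rPlus_self`, inlined), for every spin `a` — extremal included.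
[cite: arXiv07060622, §3] -/
theorem abs_rmNormSqAt_lt_of_mem_exterior {M a : ℝ} (hM : 0 < M) (x : Kerr.exterior M a) :
    |MetricCoord.rmNormSqAt (Kerr.bilin M a) x.1| < 48 / M ^ 4 := by
  have hx : max (Kerr.rPlus M a) 0 < Kerr.radius a x.1 := Kerr.mem_region.1 x.2
  have hle : M ≤ Kerr.rPlus M a := by
    unfold Kerr.rPlus
    linarith [Real.sqrt_nonneg (M ^ 2 - a ^ 2)]
  have hMr : M < Kerr.radius a x.1 := hle.trans_lt ((le_max_left _ _).trans_lt hx)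
  have hr : 0 < Kerr.radius a x.1 := hM.trans hMr
  refine (abs_rmNormSqAt_kerr_le M a hr).trans_lt ?_
  rw [div_lt_div_iff₀ (by positivity) (by positivity)]
  have h6 : M ^ 6 < Kerr.radius a x.1 ^ 6 := pow_lt_pow_left₀ hMr hM.le (by norm_num)
  nlinarith [h6, pow_pos hM 2]

/-! ### §2 Transport of the scalar to an isometric copy of the smooth Kerr exterior -/

/-- **Along a local isometry of the smooth Kerr exterior the host's Kretschmann scalar is Kerr's**:
`|Rm|²_𝓢(Ψ x) = |Rm|²_{g_{M,a}}(x)` (`Ψ^* g = g_{M,a}` is the vanishing of the Kerr–Schild deviation, G4; then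
`kretschmannAt_kerrChart`). [cite: ONeill1983, Ch. 3, pp. 90–91] -/
theorem kretschmannAt_of_isLocalIsometry_kerrExterior {𝓢 : Spacetime.{0} 4} [Kerr.Facts] {M a : ℝ} (hM : 0 ≤ M)
    {Ψ : Kerr.exterior M a → 𝓢.carrier}
    (hΨ : PseudoRiemannianMetric.IsLocalIsometry
      (Kerr.smoothMetric M a (Kerr.rPlus M a)).toPseudoRiemannianMetric 𝓢.metric.toPseudoRiemannianMetric Ψ)
    (x : Kerr.exterior M a) : 𝓢.kretschmannAt (Ψ x) = MetricCoord.rmNormSqAt (Kerr.bilin M a) x.1 :=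
  kretschmannAt_kerrChart hM hΨ.1.contMDiff (deviation_kerrBackground_eq_zero_of_isLocalIsometry M a hΨ) x

/-- **On the closure of an isometric Kerr copy the host's scalar lies in the closed value set of Kerr's** (continuity
of `kretschmannAt`). [cite: ONeill1983, Ch. 3, pp. 90–91] -/
theorem kretschmannAt_mem_closure_range_of_isLocalIsometry {𝓢 : Spacetime.{0} 4} [Kerr.Facts] {M a : ℝ}
    (hM : 0 ≤ M) {Ψ : Kerr.exterior M a → 𝓢.carrier}
    (hΨ : PseudoRiemannianMetric.IsLocalIsometry
      (Kerr.smoothMetric M a (Kerr.rPlus M a)).toPseudoRiemannianMetric 𝓢.metric.toPseudoRiemannianMetric Ψ)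
    {p : 𝓢.carrier} (hp : p ∈ closure (Set.range Ψ)) :
    𝓢.kretschmannAt p ∈ closure (Set.range fun x : Kerr.exterior M a ↦ MetricCoord.rmNormSqAt (Kerr.bilin M a) x.1) := by
  refine map_mem_closure (continuous_kretschmannAt 𝓢) hp ?_
  rintro _ ⟨x, rfl⟩
  exact ⟨x, (kretschmannAt_of_isLocalIsometry_kerrExterior hM hΨ x).symm⟩

/-- **On the closure of an isometric Kerr copy of mass `M > 0`, `| |Rm|²_𝓢 | ≤ 48 / M⁴`** (the strict bound on the
copy passes to its closure). [cite: arXiv07060622, §3] -/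
theorem abs_kretschmannAt_le_of_mem_closure_range {𝓢 : Spacetime.{0} 4} [Kerr.Facts] {M a : ℝ} (hM : 0 < M)
    {Ψ : Kerr.exterior M a → 𝓢.carrier}
    (hΨ : PseudoRiemannianMetric.IsLocalIsometry
      (Kerr.smoothMetric M a (Kerr.rPlus M a)).toPseudoRiemannianMetric 𝓢.metric.toPseudoRiemannianMetric Ψ)
    {p : 𝓢.carrier} (hp : p ∈ closure (Set.range Ψ)) : |𝓢.kretschmannAt p| ≤ 48 / M ^ 4 := by
  have hpt : ∀ y ∈ Set.range Ψ, |𝓢.kretschmannAt y| < 48 / M ^ 4 := by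
    rintro _ ⟨x, rfl⟩
    rw [kretschmannAt_of_isLocalIsometry_kerrExterior hM.le hΨ x]
    exact abs_rmNormSqAt_lt_of_mem_exterior hM x
  rw [abs_le]
  exact ⟨le_kretschmannAt_of_mem_closure (fun y hy ↦ (abs_lt.1 (hpt y hy)).1.le) hp,
    kretschmannAt_le_of_mem_closure (fun y hy ↦ (abs_lt.1 (hpt y hy)).2.le) hp⟩

/-! ### §3 The fingerprint of a Kerr shadow along a horizon generator path -/

section Along

variable {X : Type} [TopologicalSpace X] [ChartedSpace E3 X] [IsManifold (𝓡 3) ∞ X] [ConnectedSpace X]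
  {D : InitialDataSet (𝓡 3) X} {𝒟 : VacuumCauchyDevelopment D} [𝒟.metric.HasLeviCivita]
  {Λ : ℕ → ℝ≥0} {r₀ : ℝ} {γ : ℝ → 𝒟.carrier} {𝓢 : Spacetime.{0} 4} {E : EndDatum 𝓢} {p : 𝓢.carrier}

/-- **The curvature fingerprint of a Kerr shadow along `γ`.** If the horizon-hull element `(𝓢, E, p)` along the
generator path `γ` has domain of outer communications `E.doc = range Ψ` for a local isometry `Ψ` of the smooth Kerr
exterior `(M', a)`, `0 < M'` (any spin, either orientation), then `K := |Rm|²_𝓢(p)` lies in the closed value set of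
Kerr's scalar on the exterior, `|K| ≤ 48 / M'⁴`, and `K` is a cluster value at `+∞` of `s ↦ |Rm|²_𝒟(γ s)`
(`p ∈ E.horizon ⊆ closure E.doc`). [cite: Petersen2006, Ch. 10 §3.2] -/
theorem kerrShadow_fingerprint (hZ : IsHorizonHullElement 𝒟 Λ r₀ γ 𝓢 E p) [Kerr.Facts] {M' a : ℝ} (hM' : 0 < M')
    {Ψ : Kerr.exterior M' a → 𝓢.carrier} (hrange : Set.range Ψ = E.doc)
    (hΨ : PseudoRiemannianMetric.IsLocalIsometry
      (Kerr.smoothMetric M' a (Kerr.rPlus M' a)).toPseudoRiemannianMetric 𝓢.metric.toPseudoRiemannianMetric Ψ) :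
    𝓢.kretschmannAt p ∈
        closure (Set.range fun x : Kerr.exterior M' a ↦ MetricCoord.rmNormSqAt (Kerr.bilin M' a) x.1) ∧
      |𝓢.kretschmannAt p| ≤ 48 / M' ^ 4 ∧
        MapClusterPt (𝓢.kretschmannAt p) atTop (fun t : ℝ ↦ 𝒟.toSpacetime.kretschmannAt (γ t)) := by
  obtain ⟨s, hs, hZs⟩ := hZ
  have hp : p ∈ closure (Set.range Ψ) := hrange ▸ horizon_subset_closure_doc E hZs.2.2.1
  exact ⟨kretschmannAt_mem_closure_range_of_isLocalIsometry hM'.le hΨ hp,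
    abs_kretschmannAt_le_of_mem_closure_range hM' hΨ hp,
    mapClusterPt_kretschmannAt_of_isHorizonHullElement ⟨s, hs, hZs⟩⟩

/-- **Mass bound for every Kerr shadow along `γ` from a curvature floor**: if eventually `κ ≤ |Rm|²_𝒟(γ s)` with
`κ > 0`, every horizon-hull element along `γ` whose d.o.c. is an isometric copy of a Kerr exterior of mass `M' > 0`
(any spin, extremal included, either orientation) has `M'⁴ ≤ 48 / κ`. [cite: arXiv07060622, §3] -/
theorem mass_pow_four_le_of_kerrShadow_of_le (hZ : IsHorizonHullElement 𝒟 Λ r₀ γ 𝓢 E p) [Kerr.Facts] {M' a : ℝ}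
    (hM' : 0 < M') {Ψ : Kerr.exterior M' a → 𝓢.carrier} (hrange : Set.range Ψ = E.doc)
    (hΨ : PseudoRiemannianMetric.IsLocalIsometry
      (Kerr.smoothMetric M' a (Kerr.rPlus M' a)).toPseudoRiemannianMetric 𝓢.metric.toPseudoRiemannianMetric Ψ)
    {κ : ℝ} (hκ : 0 < κ) (hle : ∀ᶠ t in atTop, κ ≤ 𝒟.toSpacetime.kretschmannAt (γ t)) : M' ^ 4 ≤ 48 / κ := by
  obtain ⟨-, habs, -⟩ := kerrShadow_fingerprint hZ hM' hrange hΨ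
  have hlow : κ ≤ 𝓢.kretschmannAt p := le_kretschmannAt_of_isHorizonHullElement hZ hle
  have h1 : κ ≤ 48 / M' ^ 4 := hlow.trans ((le_abs_self _).trans habs)
  rw [le_div_iff₀ (by positivity)] at h1
  rw [le_div_iff₀ hκ]
  linarith

/-- **If the development's curvature converges along `γ`, `|K∞| · M'⁴ ≤ 48` for every Kerr shadow along `γ`.**
[cite: arXiv07060622, §3] -/
theorem abs_mul_mass_pow_four_le_of_kerrShadow_of_tendsto (hZ : IsHorizonHullElement 𝒟 Λ r₀ γ 𝓢 E p) [Kerr.Facts]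
    {M' a : ℝ} (hM' : 0 < M') {Ψ : Kerr.exterior M' a → 𝓢.carrier} (hrange : Set.range Ψ = E.doc)
    (hΨ : PseudoRiemannianMetric.IsLocalIsometry
      (Kerr.smoothMetric M' a (Kerr.rPlus M' a)).toPseudoRiemannianMetric 𝓢.metric.toPseudoRiemannianMetric Ψ)
    {K : ℝ} (hK : Tendsto (fun t : ℝ ↦ 𝒟.toSpacetime.kretschmannAt (γ t)) atTop (𝓝 K)) : |K| * M' ^ 4 ≤ 48 := by
  obtain ⟨-, habs, -⟩ := kerrShadow_fingerprint hZ hM' hrange hΨ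
  rw [kretschmannAt_eq_of_isHorizonHullElement_of_tendsto hZ hK] at habs
  rwa [le_div_iff₀ (by positivity)] at habs

/-- **Extremal specialisation (the "extremal fingerprint" of stub N).** For an EXTREMAL shadow (`Kerr.IsExtremal M' a`,
so `r₊ = M'`, the landed `MinkowskiModel.rPlus_of_isExtremal`) of a horizon-hull element along `γ`: `|Rm|²_𝓢(p)` is a
cluster value of `|Rm|²_𝒟 ∘ γ` lying in the closed value set of the extremal scalar on `{r > M'}`, of modulus
`≤ 48 / M'⁴`. [cite: arXiv07060622, §3] -/
theorem extremalShadow_fingerprint (hZ : IsHorizonHullElement 𝒟 Λ r₀ γ 𝓢 E p) [Kerr.Facts] {M' a : ℝ}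
    (hext : Kerr.IsExtremal M' a) {Ψ : Kerr.exterior M' a → 𝓢.carrier} (hrange : Set.range Ψ = E.doc)
    (hΨ : PseudoRiemannianMetric.IsLocalIsometry
      (Kerr.smoothMetric M' a (Kerr.rPlus M' a)).toPseudoRiemannianMetric 𝓢.metric.toPseudoRiemannianMetric Ψ) :
    𝓢.kretschmannAt p ∈
        closure (Set.range fun x : Kerr.exterior M' a ↦ MetricCoord.rmNormSqAt (Kerr.bilin M' a) x.1) ∧
      |𝓢.kretschmannAt p| ≤ 48 / M' ^ 4 ∧
        MapClusterPt (𝓢.kretschmannAt p) atTop (fun t : ℝ ↦ 𝒟.toSpacetime.kretschmannAt (γ t)) :=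
  kerrShadow_fingerprint hZ hext.2 hrange hΨ

end Along

/-! ### §4 Registered summary -/

/-- **Registered sub-goal of stub N — the curvature fingerprint of a Kerr shadow along a horizon generator path.**
For every horizon-hull element `(𝓢, E, p)` along `γ` whose d.o.c. is the image of a local isometry of the smooth Kerr
exterior `(M', a)`, `0 < M'` (any spin, extremal included, either orientation): `|Rm|²_𝓢(p)` lies in the closed value
set of Kerr's scalar, has modulus `≤ 48 / M'⁴`, is a cluster value at `+∞` of `s ↦ |Rm|²_𝒟(γ s)`; a curvature floor
`κ > 0` along `γ` gives `M'⁴ ≤ 48 / κ`; and `|Rm|²_𝒟 ∘ γ → K∞` gives `|K∞| · M'⁴ ≤ 48`. [cite: arXiv07060622, §3] -/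
theorem kerrShadow_fingerprint_along : ∀ {X : Type} [TopologicalSpace X] [ChartedSpace E3 X] [IsManifold (𝓡 3) ∞ X] [ConnectedSpace X] {D : InitialDataSet (𝓡 3) X} {𝒟 : VacuumCauchyDevelopment D} [𝒟.metric.HasLeviCivita] {Λ : ℕ → ℝ≥0} {r₀ : ℝ} {γ : ℝ → 𝒟.carrier} (𝓢 : Spacetime.{0} 4) (E : EndDatum 𝓢) (p : 𝓢.carrier), IsHorizonHullElement 𝒟 Λ r₀ γ 𝓢 E p → ∀ [Kerr.Facts] (M' a : ℝ), 0 < M' → ∀ (Ψ : Kerr.exterior M' a → 𝓢.carrier), Set.range Ψ = E.doc → PseudoRiemannianMetric.IsLocalIsometry (Kerr.smoothMetric M' a (Kerr.rPlus M' a)).toPseudoRiemannianMetric 𝓢.metric.toPseudoRiemannianMetric Ψ → (𝓢.kretschmannAt p ∈ closure (Set.range fun x : Kerr.exterior M' a ↦ MetricCoord.rmNormSqAt (Kerr.bilin M' a) x.1) ∧ |𝓢.kretschmannAt p| ≤ 48 / M' ^ 4 ∧ MapClusterPt (𝓢.kretschmannAt p) atTop (fun t : ℝ ↦ 𝒟.toSpacetime.kretschmannAt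 (γ t))) ∧ (∀ κ : ℝ, 0 < κ → (∀ᶠ t in atTop, κ ≤ 𝒟.toSpacetime.kretschmannAt (γ t)) → M' ^ 4 ≤ 48 / κ) ∧ ∀ K : ℝ, Tendsto (fun t : ℝ ↦ 𝒟.toSpacetime.kretschmannAt (γ t)) atTop (𝓝 K) → |K| * M' ^ 4 ≤ 48 := by
  intro X _ _ _ _ D 𝒟 _ Λ r₀ γ 𝓢 E p hZ _ M' a hM' Ψ hrange hΨ
  exact ⟨kerrShadow_fingerprint hZ hM' hrange hΨ,
    fun κ hκ hle ↦ mass_pow_four_le_of_kerrShadow_of_le hZ hM' hrange hΨ hκ hle,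
    fun K hK ↦ abs_mul_mass_pow_four_le_of_kerrShadow_of_tendsto hZ hM' hrange hΨ hK⟩

end Summit.FinalStateConjecture.FinalStateConjecture.Theorems.TameLaSalle

end
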